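import Mathlib
import Literature.NumberTheory.Sieve.Maynard2016LamSupport
import HarnessLib

/-!
# Maynard 2016: the divisors `d_j ∣ n + h_j q`, `e_j ∣ m(n + h_j q) − 1` are coprime to `P_w`

Topic `Literature/NumberTheory/Sieve`. J. Maynard, *Large gaps between primes*, Ann. of Math. (2)
183 (2016), 915–933 = arXiv:1408.5110, §4 display (4.1) and §6, proof of Lemma 6 ((6.2)–(6.3):
"we recall `(d_i e_j, P_w) = 1`") and of Lemma 7 ((6.24)–(6.25): the classes of `q`). In (4.1) the
variable `n` runs over `n ≤ U/m` with `(n(mn − 1), P_w) = 1`; since every `h_j` is a multiple of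
`P_w`, `n + h_j q ≡ n` and `m(n + h_j q) − 1 ≡ mn − 1 (mod P_w)`, so both are coprime to `P_w`, and
so is every divisor `d_j ∣ n + h_j q`, `e_j ∣ m(n + h_j q) − 1`.

PROVED here (no named facts): `mem_baseSet`, `coprime_Pw_of_mem_baseSet`,
`coprime_add_hTuple_mul_Pw`, `coprime_mul_add_hTuple_mul_sub_one_Pw`,
`coprime_Pw_of_dvd_add_hTuple_mul`, `coprime_Pw_of_dvd_mul_add_sub_one`.

## References

* J. Maynard, *Large gaps between primes*, Ann. of Math. (2) 183 (2016), 915–933; arXiv:1408.5110,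
  §4 (4.1), §6 (6.2)–(6.3) and (6.24)–(6.25). [Maynard2016LargeGaps]
-/

open Filter Finset
open scoped Topology

namespace Literature.NumberTheory.Sieve

namespace Maynard2016

/-- Membership in the range of (4.1). [cite: Maynard2016LargeGaps, §4 display (4.1)] -/
theorem mem_baseSet {C_U ε : ℝ} {x m n : ℕ} :
    n ∈ baseSet C_U ε x m ↔
      (1 ≤ n ∧ n ≤ ⌊U C_U ε x / m⌋₊) ∧ Nat.Coprime (n * (m * n - 1)) (Pw x) := by
  simp [baseSet, Finset.mem_filter, Finset.mem_Icc]

/-- For `n` in the range of (4.1): `(n, P_w) = (mn − 1, P_w) = 1`. [cite: Maynard2016LargeGaps, §4 display (4.1)] -/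
theorem coprime_Pw_of_mem_baseSet {C_U ε : ℝ} {x m n : ℕ} (hn : n ∈ baseSet C_U ε x m) :
    Nat.Coprime n (Pw x) ∧ Nat.Coprime (m * n - 1) (Pw x) := by
  have h := (mem_baseSet.1 hn).2
  exact ⟨h.coprime_mul_right, h.coprime_mul_left⟩

/-- `(n + h_j q, P_w) = (n, P_w)`: if `(n, P_w) = 1` then `(n + h_j q, P_w) = 1`. [cite: Maynard2016LargeGaps, §6 displays (6.2)–(6.3)] -/
theorem coprime_add_hTuple_mul_Pw {k x n : ℕ} (hn : Nat.Coprime n (Pw x)) (j : Fin k) (q : ℕ) :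
    Nat.Coprime (n + hTuple k x j * q) (Pw x) := by
  have h : hTuple k x j * q = (Nat.nth Nat.Prime (Nat.primeCounting k + j) * q) * Pw x := by
    unfold hTuple; ring
  rw [h]
  exact (Nat.coprime_add_mul_right_left _ _ _).2 hn

/-- `(m(n + h_j q) − 1, P_w) = (mn − 1, P_w)`: if `m, n ≥ 1` and `(mn − 1, P_w) = 1` then
`(m(n + h_j q) − 1, P_w) = 1`. [cite: Maynard2016LargeGaps, §6 displays (6.2)–(6.3)] -/
theorem coprime_mul_add_hTuple_mul_sub_one_Pw {k x m n : ℕ} (hm : 1 ≤ m) (hn1 : 1 ≤ n)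
    (hn : Nat.Coprime (m * n - 1) (Pw x)) (j : Fin k) (q : ℕ) :
    Nat.Coprime (m * (n + hTuple k x j * q) - 1) (Pw x) := by
  have h1 : 1 ≤ m * n := by
    have := Nat.mul_le_mul hm hn1
    simpa using this
  have h2 : 1 ≤ m * (n + hTuple k x j * q) :=
    le_trans h1 (Nat.mul_le_mul_left _ (Nat.le_add_right _ _))
  have h : m * (n + hTuple k x j * q) - 1 =
      (m * n - 1) + (m * (Nat.nth Nat.Prime (Nat.primeCounting k + j) * q)) * Pw x := by
    unfold hTuple
    unfold hTuple at h2
    zify [h1, h2]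
    ring
  rw [h]
  exact (Nat.coprime_add_mul_right_left _ _ _).2 hn

/-- **Every `d_j ∣ n + h_j q` is coprime to `P_w`** (for `n` in the range of (4.1)). [cite: Maynard2016LargeGaps, §6 displays (6.2)–(6.3), (6.24)] -/
theorem coprime_Pw_of_dvd_add_hTuple_mul {k : ℕ} {C_U ε : ℝ} {x m n q d : ℕ}
    (hn : n ∈ baseSet C_U ε x m) (j : Fin k) (hd : d ∣ n + hTuple k x j * q) :
    Nat.Coprime d (Pw x) :=
  Nat.Coprime.coprime_dvd_left hd (coprime_add_hTuple_mul_Pw (coprime_Pw_of_mem_baseSet hn).1 j q)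

/-- **Every `e_j ∣ m(n + h_j q) − 1` is coprime to `P_w`** (for `m ≥ 1` and `n` in the range of
(4.1)). [cite: Maynard2016LargeGaps, §6 displays (6.2)–(6.3), (6.25)] -/
theorem coprime_Pw_of_dvd_mul_add_sub_one {k : ℕ} {C_U ε : ℝ} {x m n q e : ℕ} (hm : 1 ≤ m)
    (hn : n ∈ baseSet C_U ε x m) (j : Fin k) (he : e ∣ m * (n + hTuple k x j * q) - 1) :
    Nat.Coprime e (Pw x) :=
  Nat.Coprime.coprime_dvd_left he
    (coprime_mul_add_hTuple_mul_sub_one_Pw hm (mem_baseSet.1 hn).1.1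
      (coprime_Pw_of_mem_baseSet hn).2 j q)

/-- Combined with `eventually_coprime_hTuple_sub`: for all large `x`, every `d ∣ n + h_j q` with `n`
in the range of (4.1) is coprime to `h_j − h_i` (`i ≠ j`), so `d ∣ p₀ − h_i q + h_j q` puts `q` in a
single residue class modulo `d`. [cite: Maynard2016LargeGaps, Lemma 7 (proof, «q ≡ … (mod d_j)»)] -/
theorem eventually_coprime_hTuple_sub_of_dvd (k : ℕ) (C_U ε : ℝ) :
    ∀ᶠ x : ℕ in atTop, ∀ i j : Fin k, i ≠ j → ∀ m n q d : ℕ, n ∈ baseSet C_U ε x m →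
      d ∣ n + hTuple k x j * q →
        Nat.Coprime d ((hTuple k x j : ℤ) - hTuple k x i).natAbs := by
  filter_upwards [eventually_coprime_hTuple_sub k] with x hx i j hij m n q d hn hd
  exact hx i j hij d (coprime_Pw_of_dvd_add_hTuple_mul hn j hd)

end Maynard2016

end Literature.NumberTheory.Sieve
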